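import Summits.KontsevichZagierPeriods.KontsevichZagierPeriods.Theses.AbelContraction

/-!
# Route AbelContraction — `RealHyperellipticSector` (crux stmt-KontsevichZagierPeriods-12475): the objects of the line

Definitions file of the line `Lines/birth.lean` of the programme crux `RealHyperellipticSector`
(for every `q ∈ ℚ[X]`, every value-`0` element of the subgroup of `KZ.FormalRep` generated by the
one-curve real hyperelliptic sector `[σ, (A + B√q)/D]` — `σ ⊂ {q > 0, D ≠ 0}` `ℚ`-semialgebraic,
`A B D ∈ ℚ[X]` — and the `0`-dimensional representations lies in the truncated relations
`KZ.relationsLE 1`). The registered stubs of the line are stated over the sets below; the stub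
proofs (`Theorems/AbelContractionRealHyperellipticSector*.lean`, `--supports` the crux) import this
file. Contents (all `Set KZ.FormalRep`-valued, no `Prop` definitions):

* `sector q`, `consts` — literally the two generating sets of the crux (`realHyperellipticSector_iff`
  is `Iff.rfl`);
* `arcs q` — sector generators whose domain is an open interval of the line (cell normal form);
* `cauchyRel q` — the real Cauchy relators `Σ_j (−1)^j [O_j, P/√q]` of an M-polynomial `q`
  (the engine's relators);
* `bakerKer` — the genus-`0` kernels (value-`0` arc combinations of sectors `q'` with `deg q' ≤ 2`);
* `algArcs` — real-algebraic rational arcs `[S, P/Q]`, `P, Q ∈ K[X]`, `K = algebraicClosure ℚ ℝ`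
  (the currency of the Baker sector after Euler's substitutions).

References: M. Kontsevich, D. Zagier, *Periods* (2001), §§1.1–1.2 [KontsevichZagier2001];
B. Gross, J. Harris, *Real algebraic curves*, Ann. Sci. ÉNS 14 (1981) [GrossHarris1981];
V. A. Rokhlin, *Complex orientations of real algebraic curves* (1974) [Rokhlin1974];
A. Baker, *Transcendental Number Theory* (1975), Thm 2.1 [Baker1975];
L. van den Dries, *Tame topology and o-minimal structures* (1998), Ch. 1 [Dries1998].
-/

noncomputable section

open Set MeasureTheory
open scoped BigOperators
open Literature.NumberTheory.Transcendental

namespace Summit.KontsevichZagierPeriods.AbelContraction.RealHyperellipticSector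

/-- The generators of the one-curve real hyperelliptic sector of `q ∈ ℚ[X]`: `[σ, (A + B√q)/D]` with
`σ ⊂ {q > 0, D ≠ 0}` a `ℚ`-semialgebraic subset of the line and `A B D ∈ ℚ[X]` — literally the first
set of the crux `RealHyperellipticSector`. [cite: KontsevichZagier2001, §1.1] -/
def sector (q : Polynomial ℚ) : Set KZ.FormalRep :=
  {x | ∃ (r : KZ.IntegralRep 1) (A B D : Polynomial ℚ),
      (∀ p ∈ r.domain, 0 < Polynomial.aeval (p 0) q ∧ Polynomial.aeval (p 0) D ≠ 0) ∧
      Set.EqOn r.integrand (fun p => (Polynomial.aeval (p 0) A + Polynomial.aeval (p 0) B *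
        Real.sqrt (Polynomial.aeval (p 0) q)) / Polynomial.aeval (p 0) D) r.domain ∧
      x = KZ.of r}

/-- The `0`-dimensional representations (real algebraic constants and the empty constant) —
literally the second set of the crux. [cite: KontsevichZagier2001, §1.1] -/
def consts : Set KZ.FormalRep :=
  {x | ∃ c : KZ.IntegralRep 0, x = KZ.of c}

/-- Read-back: the crux is the kernel statement on `AddSubgroup.closure (sector q ∪ consts)`.
[cite: KontsevichZagier2001, §1.2 Conjecture 1] -/
theorem realHyperellipticSector_iff :
    Summit.KontsevichZagierPeriods.KontsevichZagierPeriods.Theses.AbelContraction.RealHyperellipticSector ↔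
      ∀ (q : Polynomial ℚ), ∀ x ∈ AddSubgroup.closure (sector q ∪ consts),
        KZ.eval x = 0 → x ∈ KZ.relationsLE 1 :=
  Iff.rfl

/-- ARC generators of the sector of `q`: sector generators whose domain is an open interval of the
line (possibly unbounded or empty): `r.domain = {p | p 0 ∈ S}` with `S ⊆ ℝ` open and order-connected.
[cite: Dries1998, Ch. 1 (3.2)] -/
def arcs (q : Polynomial ℚ) : Set KZ.FormalRep :=
  {x | ∃ (r : KZ.IntegralRep 1) (A B D : Polynomial ℚ) (S : Set ℝ),
      IsOpen S ∧ S.OrdConnected ∧ r.domain = {p | p 0 ∈ S} ∧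
      (∀ p ∈ r.domain, 0 < Polynomial.aeval (p 0) q ∧ Polynomial.aeval (p 0) D ≠ 0) ∧
      Set.EqOn r.integrand (fun p => (Polynomial.aeval (p 0) A + Polynomial.aeval (p 0) B *
        Real.sqrt (Polynomial.aeval (p 0) q)) / Polynomial.aeval (p 0) D) r.domain ∧
      x = KZ.of r}

/-- Arc generators are sector generators. [folklore] -/
theorem arcs_subset_sector (q : Polynomial ℚ) : arcs q ⊆ sector q := by
  rintro x ⟨r, A, B, D, S, -, -, -, hpos, hint, rfl⟩
  exact ⟨r, A, B, D, hpos, hint, rfl⟩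

/-- The REAL CAUCHY RELATIONS of the sector of `q` (the engine's relators): `q` is an M-polynomial —
`deg q = 2g + 2`, negative leading coefficient, and `2g + 2` distinct real roots
`e 0 < e 1 < ⋯ < e (2g+1)` (so all roots are real and simple, `{q > 0}` is the union of the `g + 1`
bounded ovals `O_j = (e (2j), e (2j+1))`, and `1/√q` is single-valued on the upper half plane with
decay `|z|^{-g-1}`); for `P ∈ ℚ[X]` with `deg P < g` the form `P dx/√q` is of the first kind and
`∫_ℝ P(x) dx/√(q(x + i0)) = 0` has real part `Σ_j (−1)^j ∫_{O_j} P/√q = 0`. The relator is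
`Σ_j (−1)^j [O_j, P/√q]` for any representations `r j` with these domains and integrands (in the
sector: `A = 0, B = P, D = q`). For `g = 1` it is one rule-2 move (`GenusOneOneMove`), for rational
roots and `P = X^k` it is `HyperellipticMContraction`. [cite: GrossHarris1981, Prop. 1.1, 3.2]
[cite: Rokhlin1974] [cite: KontsevichZagier2001, §1.2] -/
def cauchyRel (q : Polynomial ℚ) : Set KZ.FormalRep :=
  {x | ∃ (g : ℕ) (e : ℕ → ℝ) (P : Polynomial ℚ) (r : Fin (g + 1) → KZ.IntegralRep 1),
      q.natDegree = 2 * g + 2 ∧ q.leadingCoeff < 0 ∧ StrictMono e ∧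
      (∀ t : ℝ, Polynomial.aeval t q = 0 ↔ ∃ i < 2 * g + 2, t = e i) ∧
      P.natDegree < g ∧
      (∀ j, (r j).domain = {p | e (2 * (j : ℕ)) < p 0 ∧ p 0 < e (2 * (j : ℕ) + 1)}) ∧
      (∀ j, Set.EqOn (r j).integrand
        (fun p => Polynomial.aeval (p 0) P / Real.sqrt (Polynomial.aeval (p 0) q)) (r j).domain) ∧
      x = ∑ j : Fin (g + 1), ((-1 : ℤ) ^ (j : ℕ)) • KZ.of (r j)}

/-- The GENUS-ZERO KERNELS (Baker sector inside dimension one): value-`0` elements of the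
arc-normalised sector subgroup of some `q'` with `deg q' ≤ 2`. [cite: Baker1975, Thm 2.1]
[cite: KontsevichZagier2001, §1.2] -/
def bakerKer : Set KZ.FormalRep :=
  {y | ∃ q' : Polynomial ℚ, q'.natDegree ≤ 2 ∧ y ∈ AddSubgroup.closure (arcs q' ∪ consts) ∧
      KZ.eval y = 0}

/-- REAL-ALGEBRAIC RATIONAL ARCS (the genus-`0` currency of the line, lead reshape r1): one-dimensional
representations whose domain is an open interval of the line and whose integrand is, on the domain,
a quotient `P/Q` of polynomials with REAL ALGEBRAIC coefficients (`K = algebraicClosure ℚ ℝ`), `Q ≠ 0`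
on the domain. Euler's substitutions carry every arc of a sector `q` with `deg q ≤ 2` to such an arc
by ONE rule-2 move (`stub_euler`), and the tree's dimension-one normal-form development
(`PiBox.Dlog.nfD_of_algK`, `kzConjecture_of_dim_le_one`) normalises exactly these integrands.
[cite: KontsevichZagier2001, §1.1] [cite: Baker1975, Thm 2.1] -/
def algArcs : Set KZ.FormalRep :=
  {x | ∃ (r : KZ.IntegralRep 1) (P Q : Polynomial (algebraicClosure ℚ ℝ)) (S : Set ℝ),
      IsOpen S ∧ S.OrdConnected ∧ r.domain = {p | p 0 ∈ S} ∧
      (∀ p ∈ r.domain, (Polynomial.aeval (p 0) Q : ℝ) ≠ 0) ∧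
      Set.EqOn r.integrand
        (fun p => (Polynomial.aeval (p 0) P : ℝ) / (Polynomial.aeval (p 0) Q : ℝ)) r.domain ∧
      x = KZ.of r}

end Summit.KontsevichZagierPeriods.AbelContraction.RealHyperellipticSector

end
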